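import Summits.MatrixMultiplication.OmegaCensus.GoldenUniform

/-!
# ω-census, family (b3): conjecture C9 — the golden groups `𝔽_p[ζ₅] ⋊ C₅`: from the class check to `¬ BoxUseful`, and the envelopes

HONEST FRAMING (pub-omega census; verbatim): lottery ticket; floor = certified bounds/negative ranges.
Census BOOKKEEPING (conjecture C9 of the cell; pub-omega stpp-1 gen 22).  Vocabulary: `GoldenClassCheck.lean`, `GoldenUniform.lean`.
* **`certOK_of_classOKG`**: a passed sign-aware CLASS check (trim coefficients) gives the exact check `CertOK` with trims
  `coefficient · ε` whenever `|x|, |y| ≤ ε`, `x > 0`, the sign datum matches `y`, and `2·Smax·ε < p` (`pairOK_of_OKsf`);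
* **`not_boxUseful_of_certOK_count`** (exact count `card_blockArcSet`, decidable for numerals) and
  **`not_boxUseful_of_classOKG`** (uniform bound `576 p² ≤ 5 (p − 7)(MIS (p − 7) − Σt·ε)`, per-block `block_bound`);
* the numeric envelope `EnvOK M L Smax s P₀` (decidable) and `env_of_envOK`: `p ≥ P₀ ≥ s²`, `ε² ≤ p` give both size conditions;
* `CertDataG` / `CertDataG.Valid` (decidable) / **`CertDataG.not_boxUseful_of_valid`**: per-prime certificates as data.
Tables, certificates and the assembled theorems are in the successor files.  Nothing here is progress on `ω`.
-/

namespace Summit.MatrixMultiplication.OmegaCensus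

open Finset

namespace GoldArcs

open EisArcs (PhiR eight_val_div phase_residue bLen eight_mul_bLen_ge)
open QuadArcs (blockCells blockArcSet patIndep_blockCells blockArcSet_subset card_blockArcSet)

variable {p : ℕ} {τ : ZMod p}

/-! ### From the class check to the exact check -/

/-- One coordinate: the sign-aware residue clause `OKsf` with `|x|, |y| ≤ ε`, `Sab C ≤ Smax`, `2·Smax·ε < p` gives `PairOK` for the
exact error `C₀x + C₁y` and the trims `coefficient · ε`. [folklore] -/
theorem pairOK_of_OKsf {σ x y : ℤ} {ε Smax : ℕ} (hx : 0 < x) (hy₁ : σ = 1 → 0 ≤ y) (hy₂ : σ = -1 → y ≤ 0)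
    (hxe : |x| ≤ ε) (hye : |y| ≤ ε) (hS : 2 * Smax * ε < p) {C : ℤ × ℤ} (hC : Sab C ≤ Smax)
    {Φv φ φ' : ℤ} {lo hi lo' hi' : ℕ} (h : OKsf σ Φv C φ φ' lo hi lo' hi') :
    PhaseArcs.PairOK p Φv (evZ x y C) φ φ' ((lo * ε : ℕ) : ℤ) ((hi * ε : ℕ) : ℤ) ((lo' * ε : ℕ) : ℤ) ((hi' * ε : ℕ) : ℤ) := by
  obtain ⟨h0, hplus, hminus⟩ := h
  have hε0 : (0 : ℤ) ≤ ε := Nat.cast_nonneg _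
  have hE : |evZ x y C| ≤ Sab C * ε := abs_evZ_le hxe hye C
  have hE' : |evZ x y C| ≤ (Smax : ℤ) * ε := hE.trans (mul_le_mul_of_nonneg_right hC hε0)
  have hS' : 2 * (Smax : ℤ) * ε < p := by exact_mod_cast hS
  refine ⟨by linarith [abs_nonneg (evZ x y C)], h0, ?_, ?_⟩
  · intro h1 hpos
    rcases hplus h1 with hn | hle | hle
    · exact absurd hpos (not_lt.2 (evZ_nonpos hx hy₁ hy₂ hn))
    · left
      push_cast
      calc evZ x y C ≤ |evZ x y C| := le_abs_self _
        _ ≤ Sab C * ε := hE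
        _ ≤ (hi' : ℤ) * ε := mul_le_mul_of_nonneg_right hle hε0
    · right
      push_cast
      calc evZ x y C ≤ |evZ x y C| := le_abs_self _
        _ ≤ Sab C * ε := hE
        _ ≤ (lo : ℤ) * ε := mul_le_mul_of_nonneg_right hle hε0
  · intro h1 hneg
    rcases hminus h1 with hn | hle | hle
    · exact absurd hneg (not_lt.2 (evZ_nonneg hx hy₁ hy₂ hn))
    · left
      push_cast
      calc -evZ x y C ≤ |evZ x y C| := neg_le_abs _
        _ ≤ Sab C * ε := hE
        _ ≤ (lo' : ℤ) * ε := mul_le_mul_of_nonneg_right hle hε0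
    · right
      push_cast
      calc -evZ x y C ≤ |evZ x y C| := neg_le_abs _
        _ ≤ Sab C * ε := hE
        _ ≤ (hi : ℤ) * ε := mul_le_mul_of_nonneg_right hle hε0

/-- **A passed class check gives the exact check** with trims `coefficient · ε` (`x > 0`, sign datum matching `y`,
`|x|, |y| ≤ ε`, residues `γ₀ = −px`, `γ₁ = −py (mod 8)`, `2·Smax·ε < p`). [folklore] -/
theorem certOK_of_classOKG (cd : ClassDataG) {σ : ℤ} {γ₀ γ₁ : ZMod 8} {Smax : ℕ} (hok : cd.ClassOKG σ γ₀ γ₁ Smax)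
    {x y : ℤ} {ε : ℕ} (hx : 0 < x) (hy₁ : σ = 1 → 0 ≤ y) (hy₂ : σ = -1 → y ≤ 0) (hxe : |x| ≤ ε) (hye : |y| ≤ ε)
    (hγ₀ : -((p : ZMod 8) * x) = γ₀) (hγ₁ : -((p : ZMod 8) * y) = γ₁) (hS : 2 * Smax * ε < p) :
    CertOK p x y cd.A cd.B cd.t cd.P (fun c φ => cd.lo₁ c φ * ε) (fun c φ => cd.hi₁ c φ * ε)
      (fun c φ => cd.lo₂ c φ * ε) (fun c φ => cd.hi₂ c φ * ε) := by
  obtain ⟨-, -, -, -, hSm, hpair⟩ := hok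
  intro c c' hcc φ hφ φ' hφ'
  rw [hγ₀, hγ₁]
  obtain ⟨hSR, hSI⟩ := hSm c c' hcc
  rcases hpair c c' hcc φ hφ φ' hφ' with h | h
  · exact Or.inl (pairOK_of_OKsf hx hy₁ hy₂ hxe hye hS hSR h)
  · exact Or.inr (pairOK_of_OKsf hx hy₁ hy₂ hxe hye hS hSI h)

/-! ### The two counts -/

/-- **`¬ BoxUseful` from the exact check and the exact count** (`card_blockArcSet`; decidable for numerals). [folklore] -/
theorem not_boxUseful_of_certOK_count [Fact p.Prime] [hτ : Fact (τ ^ 2 + τ = 1)] (hp : 3 ≤ p) (x y : ℤ)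
    (hyx : (y : ZMod p) = τ * x) (A B : (ℤ × ℤ) × (ℤ × ℤ)) (t : ZMod 5)
    (hA : NondegZ p x y A) (hB : NondegZ p x y B) (ht : t ≠ 0)
    (P : Fin 3 × Fin 3 → Finset (ℤ × ℤ)) (lo₁ hi₁ lo₂ hi₂ : Fin 3 × Fin 3 → ℤ × ℤ → ℕ)
    (hP : ∀ c, ∀ φ ∈ P c, (0 ≤ φ.1 ∧ φ.1 < 8) ∧ (0 ≤ φ.2 ∧ φ.2 < 8))
    (hok : CertOK p x y A B t P lo₁ hi₁ lo₂ hi₂)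
    (hbig : 9 * (p * p) ≤ 5 * ∑ c, ∑ φ ∈ P c,
      (bLen p φ.1 (lo₁ c φ) (hi₁ c φ)).toNat * (bLen p φ.2 (lo₂ c φ) (hi₂ c φ)).toNat) :
    ¬ BoxUseful (GoldCyc p τ) := by
  haveI : NeZero p := ⟨(Fact.out : p.Prime).ne_zero⟩
  obtain ⟨D, hD, indep⟩ := exists_indep_of_certOK hp hτ.out x y hyx A B t hA hB ht P lo₁ hi₁ lo₂ hi₂ hP hok
  refine D.not_boxUseful_of_pattern Gold.gz hD indep ?_
  have hl₁ : ∀ c, ∀ φ ∈ P c, (0 : ℤ) ≤ (fun c φ => (lo₁ c φ : ℤ)) c φ := fun c φ _ => Nat.cast_nonneg _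
  have hh₁ : ∀ c, ∀ φ ∈ P c, (0 : ℤ) ≤ (fun c φ => (hi₁ c φ : ℤ)) c φ := fun c φ _ => Nat.cast_nonneg _
  have hl₂ : ∀ c, ∀ φ ∈ P c, (0 : ℤ) ≤ (fun c φ => (lo₂ c φ : ℤ)) c φ := fun c φ _ => Nat.cast_nonneg _
  have hh₂ : ∀ c, ∀ φ ∈ P c, (0 : ℤ) ≤ (fun c φ => (hi₂ c φ : ℤ)) c φ := fun c φ _ => Nat.cast_nonneg _
  rw [Gold.card, card_blockArcSet hP hl₁ hh₁ hl₂ hh₂]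
  exact hbig

/-- Per block: `(p − 7)(p − 7 − (L₁ + L₂)) ≤ 64·N₁N₂` for arc lengths `8 N_i ≥ p − 7 − L_i` (`N_i ≥ 0`, `L_i ≥ 0`). [folklore] -/
theorem block_bound {q L₁ L₂ N₁ N₂ : ℤ} (hq : 7 ≤ q) (hL₁ : 0 ≤ L₁) (hL₂ : 0 ≤ L₂) (hN₁ : 0 ≤ N₁) (hN₂ : 0 ≤ N₂)
    (e1 : q - 7 - L₁ ≤ 8 * N₁) (e2 : q - 7 - L₂ ≤ 8 * N₂) : (q - 7) * (q - 7 - (L₁ + L₂)) ≤ 64 * (N₁ * N₂) := by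
  by_cases h1 : 0 ≤ q - 7 - L₁
  · by_cases h2 : 0 ≤ q - 7 - L₂
    · have prod := mul_le_mul e1 e2 h2 (by linarith)
      nlinarith [mul_nonneg hL₁ hL₂]
    · have : q - 7 - (L₁ + L₂) ≤ 0 := by linarith
      nlinarith [mul_nonneg hN₁ hN₂]
  · have : q - 7 - (L₁ + L₂) ≤ 0 := by linarith
    nlinarith [mul_nonneg hN₁ hN₂]

/-- **`¬ BoxUseful` from a passed class check and the uniform count bound** `576 p² ≤ 5 (p − 7)(MIS (p − 7) − Σt·ε)`. [folklore] -/
theorem not_boxUseful_of_classOKG [Fact p.Prime] [Fact (τ ^ 2 + τ = 1)] (hp : 49 ≤ p) (x y : ℤ)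
    (hx0 : (x : ZMod p) ≠ 0) (hyx : (y : ZMod p) = τ * x) (hx : 0 < x) {σ : ℤ} (hy₁ : σ = 1 → 0 ≤ y) (hy₂ : σ = -1 → y ≤ 0)
    {ε : ℕ} (hxe : |x| ≤ ε) (hye : |y| ≤ ε) (cd : ClassDataG) {γ₀ γ₁ : ZMod 8} (hγ₀ : -((p : ZMod 8) * x) = γ₀)
    (hγ₁ : -((p : ZMod 8) * y) = γ₁) {Smax : ℕ} (hok : cd.ClassOKG σ γ₀ γ₁ Smax) (hS : 2 * Smax * ε < p)
    (hcount : 576 * (p : ℤ) ^ 2 ≤ 5 * ((p : ℤ) - 7) * (cd.MIS * ((p : ℤ) - 7) - cd.SigT * ε)) :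
    ¬ BoxUseful (GoldCyc p τ) := by
  haveI : NeZero p := ⟨(Fact.out : p.Prime).ne_zero⟩
  have hcert := certOK_of_classOKG cd hok hx hy₁ hy₂ hxe hye hγ₀ hγ₁ hS
  obtain ⟨hA, hB, ht, hP, -, -⟩ := hok
  have hτ : τ ^ 2 + τ = 1 := Fact.out
  refine not_boxUseful_of_certOK_count (by omega) x y hyx cd.A cd.B cd.t (nondegZ_of_small hp hτ hx0 hyx hA)
    (nondegZ_of_small hp hτ hx0 hyx hB) ht cd.P _ _ _ _ hP hcert ?_
  -- the count
  obtain ⟨A, B, t, P, lo₁, hi₁, lo₂, hi₂⟩ := cd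
  dsimp only at hP hcount ⊢
  have hp7 : (7 : ℤ) ≤ p := by exact_mod_cast (show 7 ≤ p by omega)
  have hε0 : (0 : ℤ) ≤ ε := Nat.cast_nonneg _
  have hblock : ∀ c, ∀ φ ∈ P c, ((p : ℤ) - 7) * ((p : ℤ) - 7 - ((lo₁ c φ + hi₁ c φ + lo₂ c φ + hi₂ c φ : ℕ) : ℤ) * ε) ≤
      64 * (((bLen p φ.1 ((lo₁ c φ * ε : ℕ) : ℤ) ((hi₁ c φ * ε : ℕ) : ℤ)).toNat *
        (bLen p φ.2 ((lo₂ c φ * ε : ℕ) : ℤ) ((hi₂ c φ * ε : ℕ) : ℤ)).toNat : ℕ) : ℤ) := by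
    intro c φ _
    have e1 := eight_mul_bLen_ge (p := p) φ.1 ((lo₁ c φ * ε : ℕ) : ℤ) ((hi₁ c φ * ε : ℕ) : ℤ)
    have e2 := eight_mul_bLen_ge (p := p) φ.2 ((lo₂ c φ * ε : ℕ) : ℤ) ((hi₂ c φ * ε : ℕ) : ℤ)
    set N₁ := (bLen p φ.1 ((lo₁ c φ * ε : ℕ) : ℤ) ((hi₁ c φ * ε : ℕ) : ℤ)).toNat with hN₁
    set N₂ := (bLen p φ.2 ((lo₂ c φ * ε : ℕ) : ℤ) ((hi₂ c φ * ε : ℕ) : ℤ)).toNat with hN₂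
    have t1 : bLen p φ.1 ((lo₁ c φ * ε : ℕ) : ℤ) ((hi₁ c φ * ε : ℕ) : ℤ) ≤ (N₁ : ℤ) := Int.self_le_toNat _
    have t2 : bLen p φ.2 ((lo₂ c φ * ε : ℕ) : ℤ) ((hi₂ c φ * ε : ℕ) : ℤ) ≤ (N₂ : ℤ) := Int.self_le_toNat _
    have hb := block_bound (q := (p : ℤ)) (L₁ := ((lo₁ c φ + hi₁ c φ : ℕ) : ℤ) * ε) (L₂ := ((lo₂ c φ + hi₂ c φ : ℕ) : ℤ) * ε)
      (N₁ := (N₁ : ℤ)) (N₂ := (N₂ : ℤ)) hp7 (by positivity) (by positivity) (Nat.cast_nonneg _) (Nat.cast_nonneg _)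
      (by push_cast at e1 t1 ⊢; linarith) (by push_cast at e2 t2 ⊢; linarith)
    push_cast at hb ⊢
    linarith
  have hsum : ((p : ℤ) - 7) * (((ClassDataG.MIS ⟨A, B, t, P, lo₁, hi₁, lo₂, hi₂⟩ : ℕ) : ℤ) * ((p : ℤ) - 7)
      - ((ClassDataG.SigT ⟨A, B, t, P, lo₁, hi₁, lo₂, hi₂⟩ : ℕ) : ℤ) * ε) ≤
      64 * ((∑ c, ∑ φ ∈ P c, (bLen p φ.1 ((lo₁ c φ * ε : ℕ) : ℤ) ((hi₁ c φ * ε : ℕ) : ℤ)).toNat *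
        (bLen p φ.2 ((lo₂ c φ * ε : ℕ) : ℤ) ((hi₂ c φ * ε : ℕ) : ℤ)).toNat : ℕ) : ℤ) := by
    simp only [ClassDataG.MIS, ClassDataG.SigT]
    push_cast
    rw [Finset.sum_mul, Finset.sum_mul, ← Finset.sum_sub_distrib, Finset.mul_sum, Finset.mul_sum]
    refine Finset.sum_le_sum fun c _ => ?_
    have hconst : (#(P c) : ℤ) * ((p : ℤ) - 7) = ∑ φ ∈ P c, ((p : ℤ) - 7) := by
      rw [Finset.sum_const, nsmul_eq_mul]
    rw [hconst, Finset.sum_mul, ← Finset.sum_sub_distrib, Finset.mul_sum, Finset.mul_sum]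
    refine Finset.sum_le_sum fun φ hφ => ?_
    have hb := hblock c φ hφ
    push_cast at hb ⊢
    linarith
  have hfin : 9 * ((p : ℤ) * p) ≤ 5 * ((∑ c, ∑ φ ∈ P c,
      (bLen p φ.1 ((lo₁ c φ * ε : ℕ) : ℤ) ((hi₁ c φ * ε : ℕ) : ℤ)).toNat *
        (bLen p φ.2 ((lo₂ c φ * ε : ℕ) : ℤ) ((hi₂ c φ * ε : ℕ) : ℤ)).toNat : ℕ) : ℤ) := by
    nlinarith [hsum, hcount]
  exact_mod_cast hfin

/-! ### Numeric envelopes: from `p ≥ P₀ ≥ s²`, `ε² ≤ p` to the size conditions -/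

/-- `s·ε ≤ p` when `s² ≤ P₀ ≤ p` and `ε² ≤ p`. [folklore] -/
theorem s_mul_eps_le {s P₀ q ε : ℤ} (hε : 0 ≤ ε) (hsP : s * s ≤ P₀) (hP : P₀ ≤ q) (hεq : ε * ε ≤ q) :
    s * ε ≤ q := by
  have hq : 0 ≤ q := by nlinarith
  by_contra h
  push Not at h
  have h2 : q * q < (s * ε) * (s * ε) := mul_self_lt_mul_self hq h
  nlinarith [mul_le_mul hsP hεq (by positivity) ((mul_self_nonneg s).trans hsP)]

/-- `2·Smax·ε < p` when `2·Smax < s`, `s² ≤ P₀ ≤ p`, `ε² ≤ p`. [folklore] -/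
theorem two_mul_lt_of_env {Smax s P₀ q ε : ℤ} (hS0 : 0 ≤ Smax) (hS : 2 * Smax < s) (hε : 0 ≤ ε) (hsP : s * s ≤ P₀)
    (hP : P₀ ≤ q) (hεq : ε * ε ≤ q) : 2 * Smax * ε < q := by
  have hse := s_mul_eps_le hε hsP hP hεq
  have hq : 0 < q := by nlinarith
  rcases eq_or_lt_of_le hε with h | h
  · rw [← h, mul_zero]; exact hq
  · nlinarith

/-- The decidable numeric envelope of a class: leading coefficient, value and slope at `P₀` of
`Q(p) = 5(p − 7)(M s (p − 7) − L p) − 576 s p²`, plus `2·Smax < s`, `s² ≤ P₀`, `7 ≤ P₀`. [folklore] -/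
def EnvOK (M L Smax s P₀ : ℕ) : Prop :=
  0 < (s : ℤ) ∧ (s : ℤ) * s ≤ P₀ ∧ (7 : ℤ) ≤ P₀ ∧ 2 * (Smax : ℤ) < s ∧
    0 < 5 * ((M : ℤ) * s - L) - 576 * s ∧
    0 ≤ (5 * ((M : ℤ) * s - L) - 576 * s) * P₀ * P₀ - 35 * (2 * (M : ℤ) * s - L) * P₀ + 245 * (M : ℤ) * s ∧
    0 ≤ 2 * (5 * ((M : ℤ) * s - L) - 576 * s) * P₀ - 35 * (2 * (M : ℤ) * s - L)

/-- `EnvOK` is decidable. [folklore] -/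
instance (M L Smax s P₀ : ℕ) : Decidable (EnvOK M L Smax s P₀) := by unfold EnvOK; infer_instance

/-- **The count envelope.** `EnvOK M L Smax s P₀`, `p ≥ P₀`, `ε² ≤ p` give `576 p² ≤ 5 (p − 7)(M (p − 7) − L ε)` and
`2·Smax·ε < p`. [folklore] -/
theorem env_of_envOK {M L Smax s P₀ : ℕ} (h : EnvOK M L Smax s P₀) {q ε : ℤ} (hP : (P₀ : ℤ) ≤ q) (hε : 0 ≤ ε)
    (hεq : ε * ε ≤ q) : 576 * q ^ 2 ≤ 5 * (q - 7) * ((M : ℤ) * (q - 7) - (L : ℤ) * ε) ∧ 2 * (Smax : ℤ) * ε < q := by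
  obtain ⟨hs, hsP, h7, hS, hα, hQ, hd⟩ := h
  have hse : (s : ℤ) * ε ≤ q := s_mul_eps_le hε hsP hP hεq
  refine ⟨?_, two_mul_lt_of_env (Nat.cast_nonneg _) hS hε hsP hP hεq⟩
  set α : ℤ := 5 * ((M : ℤ) * s - L) - 576 * s with hαdef
  set β : ℤ := -(35 * (2 * (M : ℤ) * s - L)) with hβdef
  set γ : ℤ := 245 * (M : ℤ) * s with hγdef
  have hQ' : 0 ≤ α * P₀ * P₀ + β * P₀ + γ := by rw [hβdef, hγdef]; linarith
  have hd' : 0 ≤ 2 * α * P₀ + β := by rw [hβdef]; linarith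
  -- `Q(q) ≥ Q(P₀) ≥ 0`
  have hQq : 0 ≤ α * q * q + β * q + γ := by
    have hdiff : α * q * q + β * q + γ - (α * P₀ * P₀ + β * P₀ + γ) = (q - P₀) * (α * (q + P₀) + β) := by ring
    have h1 : 0 ≤ α * (q + (P₀ : ℤ)) + β := by nlinarith
    nlinarith
  -- `Q(q) = 5 (q − 7)(M s (q − 7) − L q) − 576 s q²`
  have hQid : α * q * q + β * q + γ = 5 * (q - 7) * ((M : ℤ) * s * (q - 7) - L * q) - 576 * s * q ^ 2 := by
    rw [hαdef, hβdef, hγdef]; ring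
  have hL : (0 : ℤ) ≤ L := Nat.cast_nonneg _
  have hq7 : 0 ≤ q - 7 := by linarith
  -- `s · RHS ≥ 5 (q − 7)(M s (q − 7) − L q) ≥ 576 s q²`
  have key : (s : ℤ) * (5 * (q - 7) * ((M : ℤ) * (q - 7) - L * ε)) ≥ 576 * s * q ^ 2 := by
    have h1 : (s : ℤ) * (5 * (q - 7) * ((M : ℤ) * (q - 7) - L * ε)) =
        5 * (q - 7) * ((M : ℤ) * s * (q - 7) - L * (s * ε)) := by ring
    rw [h1]
    have h2 : (M : ℤ) * s * (q - 7) - L * q ≤ (M : ℤ) * s * (q - 7) - L * (s * ε) := by nlinarith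
    nlinarith [mul_le_mul_of_nonneg_left h2 (by linarith : (0 : ℤ) ≤ 5 * (q - 7))]
  by_contra hc
  push Not at hc
  have : (s : ℤ) * (5 * (q - 7) * ((M : ℤ) * (q - 7) - L * ε)) < s * (576 * q ^ 2) := mul_lt_mul_of_pos_left hc hs
  linarith

/-! ### Per-prime certificates as data -/

/-- A per-prime certificate: the Thue pair `(x, y)`, the box `(A, B, t)`, the 2-D phase pattern and the four integer trim tables.
[folklore] -/
structure CertDataG where
  /-- Thue pair, first coordinate (`x > 0` by convention) -/
  x : ℤ
  /-- Thue pair, second coordinate (`y ≡ τ x`) -/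
  y : ℤ
  /-- lattice coordinates of `α` -/
  A : (ℤ × ℤ) × (ℤ × ℤ)
  /-- lattice coordinates of `β` -/
  B : (ℤ × ℤ) × (ℤ × ℤ)
  /-- the `b`-exponent of the third `W`-element -/
  t : ZMod 5
  /-- phase pairs used per column -/
  P : Fin 3 × Fin 3 → Finset (ℤ × ℤ)
  /-- bottom trims, real coordinate -/
  lo₁ : Fin 3 × Fin 3 → ℤ × ℤ → ℕ
  /-- top trims, real coordinate -/
  hi₁ : Fin 3 × Fin 3 → ℤ × ℤ → ℕ
  /-- bottom trims, imaginary coordinate -/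
  lo₂ : Fin 3 × Fin 3 → ℤ × ℤ → ℕ
  /-- top trims, imaginary coordinate -/
  hi₂ : Fin 3 × Fin 3 → ℤ × ℤ → ℕ

namespace CertDataG

variable (cd : CertDataG)

/-- The exact cell count `Σ_c Σ_φ len₁ · len₂` of the certificate at the prime `p`. [folklore] -/
def count (p : ℕ) : ℕ :=
  ∑ c, ∑ φ ∈ cd.P c, (bLen p φ.1 (cd.lo₁ c φ) (cd.hi₁ c φ)).toNat * (bLen p φ.2 (cd.lo₂ c φ) (cd.hi₂ c φ)).toNat

/-- **Validity of a certificate** at `(p, τ)` (decidable for numerals): `y ≡ τx`, numeric nondegeneracy of `α`, `β`, `t ≠ 0`,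
phases in `[0,8)²`, the exact pair check, and the count `9p² ≤ 5·count`. [folklore] -/
def Valid (p : ℕ) (τ : ZMod p) : Prop :=
  (cd.y : ZMod p) = τ * cd.x ∧ NondegZ p cd.x cd.y cd.A ∧ NondegZ p cd.x cd.y cd.B ∧ cd.t ≠ 0 ∧
    (∀ c, ∀ φ ∈ cd.P c, (0 ≤ φ.1 ∧ φ.1 < 8) ∧ (0 ≤ φ.2 ∧ φ.2 < 8)) ∧
    CertOK p cd.x cd.y cd.A cd.B cd.t cd.P cd.lo₁ cd.hi₁ cd.lo₂ cd.hi₂ ∧ 9 * (p * p) ≤ 5 * cd.count p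

/-- Validity is decidable. [folklore] -/
instance (p : ℕ) [NeZero p] (τ : ZMod p) : Decidable (cd.Valid p τ) := by unfold Valid; infer_instance

/-- **A valid certificate makes `GoldCyc p τ` not box-useful** (`p ≥ 3` prime). [folklore] -/
theorem not_boxUseful_of_valid {p : ℕ} [Fact p.Prime] {τ : ZMod p} [Fact (τ ^ 2 + τ = 1)] (hp : 3 ≤ p)
    (h : cd.Valid p τ) : ¬ BoxUseful (GoldCyc p τ) := by
  obtain ⟨hyx, hA, hB, ht, hP, hok, hbig⟩ := h
  exact not_boxUseful_of_certOK_count hp cd.x cd.y hyx cd.A cd.B cd.t hA hB ht cd.P _ _ _ _ hP hok hbig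

end CertDataG

end GoldArcs

end Summit.MatrixMultiplication.OmegaCensus
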